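import Summits.BirchSwinnertonDyer.BirchSwinnertonDyer.Theorems.SignedLowerHalvesSmallImageLowerHalfBothSignsRttD2SeqJ3TracePairing
import Literature.NumberTheory.GaloisRepresentations.LocalKummerTorsion
import Mathlib.RingTheory.Trace.Basic
import Mathlib.NumberTheory.Padics.RingHoms
import HarnessLib

/-!
# Route `SignedLowerHalves`, crux L `SmallImageLowerHalfBothSigns` (stmt-BirchSwinnertonDyer-23599), line `rtt_w3` v14 → v15 — E2, row J3 (Galois side, part β₃d′, stage 1 — GENERAL LINEAR FORM):
# THE `λ`-COEFFICIENT PAIRING `𝒪 ⊗ μ_{p^k} × 𝒪 → μ_{p^k}`, `(a ⊗ ζ, x) ↦ λ(a x) · ζ` FOR ANY `ℤ_p`-LINEAR `λ : 𝒪 → ℤ_p` (the trace version p791019 is `λ = Tr`; for RAMIFIED `𝒪/ℤ_p` the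
# PERFECT choice is `λ = Tr(δ⁻¹ ·)`, `δ` a generator of the different — the trace form itself is then degenerate mod `p^k`, which would break `hsolL`) — in coordinates (no Galois module yet), with its three laws:
# `𝒪`-balance, `p^k 𝒪` in the right kernel, level compatibility (`red = id ⊗ (ζ ↦ ζ^p)` on the left ↔ `x ↦ p x` and `μ_{p^k} ⊆ μ_{p^{k+1}}`), and the character twist law

WIDTH seat `bsd-line-slh-p3-w3` g22 under LEAD `cruxlead-stmt-BirchSwinnertonDyer-23599` g11 (cell `bsd-ssimc`); helper `--supports stmt-BirchSwinnertonDyer-23599`.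
DEFINITIONS WITH BODIES + THEOREMS; no named fact, no instance, no `sorry`. HONEST FRAMING: the `λ`-parametrised twin of p791019 (same proofs with `Algebra.trace` replaced by a `ℤ_p`-linear `λ`, hypothesis `hlam`), so that junction-1 can choose a PERFECT `λ`; stage 1 of the remaining input (β₃d) "coefficient pairings `Pk`" of
`exists_junction_exact_of_inputs` (p790304) for the LEAD's `M = Cofree θ F` (rank one, `M[p^k] ≅ 𝒪/p^k`): the pairing on COORDINATES `x ∈ 𝒪`; stage 2 (the coordinate
`M[p^k] ≅ 𝒪/p^k` of `Cofree θ F`) and stage 3 (Galois equivariance `θ′θ = 1`, packaging as `ContPairing`, the binders `hPred`/`hPsc`) are the sequel. E2, crux L/M, BSD remain OPEN.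

* §1 (`n • ζ = 0` is the tree's `PoitouTateReduction.mu_nsmul_eq_zero_level`, inlined) `zmodSMulMu n ζ : ℤ/n →+ μ_n` (`t ↦ t·ζ`, `ZMod.lift`), `lamZMod S lam k : 𝒪 →+ ℤ/p^k` (`Tr_{𝒪/ℤ_p}` then `toZModPow`).
* §2 ★ `lamPairing S K lam k : OMuCarrier K S (p^k) →+ (𝒪 →+ μ_{p^k})`, `lamPairing_tmul`; ★ `lamPairing_oMuScalar` (balance `((c ⊗ id) w, x) = (w, c x)`),
  ★ `lamPairing_mul_pow_eq_zero` (`(w, p^k y) = 0`), ★ `muInclusion_lamPairing_oMuRed` (level law `ι((red w, y)_k) = (w, p y)_{k+1}`), ★ `lamPairing_muTwistO` (twist law: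
  `(σ·w, t x) = σ·(w, x)` whenever `θ′(σ) t = 1` — the Galois equivariance against `(F/𝒪)(θ)` once `t = θ(σ)`).
References: [NeukirchSchmidtWingberg2008] (7.2.6); [Rubin2000] §4.2 (the pairing `T*/p^k × W[p^k] → μ_{p^k}`); [JohnsonLeungKings2011] Def. 4.2.
-/

set_option autoImplicit false
set_option linter.dupNamespace false -- D-0017: single-problem summit, the namespace repeats the problem name by design
noncomputable section

open scoped Classical TensorProduct
open NumberField IsDedekindDomain Field

namespace Summit.BirchSwinnertonDyer.BirchSwinnertonDyer.Theorems.SmallImageRttD2Seq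

open Literature.NumberTheory.EllipticCurves Literature.NumberTheory.GaloisRepresentations Literature.NumberTheory.GaloisRepresentations.DiscreteGaloisModule
  Literature.NumberTheory.ComplexMultiplication.EllipticUnits.JohnsonLeungKings2011

/-! ## §1. `ℤ/n` acting on `μ_n`, and the trace mod `p^k` -/


section Trace

variable {p : ℕ} [Fact p.Prime] (S : Set (PadicAlgCl p)) (lam : padicCoeffIntegers S →+ ℤ_[p])
  (hlam : ∀ (c : ℤ_[p]) (y : padicCoeffIntegers S), lam (padicIntToCoeffIntegers S c * y) = c * lam y)

/-- **`λ mod p^k : 𝒪 →+ ℤ/p^k`** for a `ℤ_p`-linear form `λ : 𝒪 → ℤ_p`. [cite: NeukirchSchmidtWingberg2008, (7.2.6)] -/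
def lamZMod (k : ℕ) : padicCoeffIntegers S →+ ZMod (p ^ k) :=
  (PadicInt.toZModPow k).toAddMonoidHom.comp lam

/-- Unfolding `lamZMod`. [folklore] -/
theorem lamZMod_apply (k : ℕ) (x : padicCoeffIntegers S) : lamZMod S lam k x = PadicInt.toZModPow k (lam x) := rfl

include hlam in
/-- `lamZMod` is `ℤ_p`-semilinear. [folklore] -/
theorem lamZMod_padicInt_mul (k : ℕ) (c : ℤ_[p]) (y : padicCoeffIntegers S) :
    lamZMod S lam k (padicIntToCoeffIntegers S c * y) = PadicInt.toZModPow k c * lamZMod S lam k y := by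
  rw [lamZMod_apply, lamZMod_apply, hlam, map_mul]

include hlam in
/-- `λ(p^k y) ≡ 0 (mod p^k)`. [folklore] -/
theorem lamZMod_natCast_pow_mul (k : ℕ) (y : padicCoeffIntegers S) : lamZMod S lam k (((p : ℕ) : padicCoeffIntegers S) ^ k * y) = 0 := by
  rw [show ((p : ℕ) : padicCoeffIntegers S) ^ k = padicIntToCoeffIntegers S ((p : ℤ_[p]) ^ k) by rw [map_pow, map_natCast], lamZMod_padicInt_mul S lam hlam,
    map_pow, map_natCast, ← Nat.cast_pow, ZMod.natCast_self, zero_mul]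

/-- Level change of the trace: `Tr_{k+1}(p y)` is `p · Tr_{k+1}(y)` and reduces to `Tr_k(y)`. [folklore] -/
theorem lamZMod_succ_cast (k : ℕ) (y : padicCoeffIntegers S) : (ZMod.castHom (pow_dvd_pow p (Nat.le_succ k)) (ZMod (p ^ k)) (lamZMod S lam (k + 1) y)) = lamZMod S lam k y := by
  rw [lamZMod_apply, lamZMod_apply, ZMod.castHom_apply, PadicInt.cast_toZModPow k (k + 1) (Nat.le_succ k)]

end Trace

/-! ## §2. The trace pairing `𝒪 ⊗ μ_{p^k} × 𝒪 → μ_{p^k}` -/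

section Pairing

variable {p : ℕ} [Fact p.Prime] (S : Set (PadicAlgCl p)) (K : Type) [Field K] (lam : padicCoeffIntegers S →+ ℤ_[p])
  (hlam : ∀ (c : ℤ_[p]) (y : padicCoeffIntegers S), lam (padicIntToCoeffIntegers S c * y) = c * lam y)

/-- The pairing on pure tensors: `a ↦ ζ ↦ (x ↦ λ(a x)·ζ)`. [cite: Rubin2000, §4.2] -/
def lamPairingAux (k : ℕ) : padicCoeffIntegers S →+ MuCarrier K (p ^ k) →+ (padicCoeffIntegers S →+ MuCarrier K (p ^ k)) :=
  haveI : NeZero (p ^ k) := ⟨pow_ne_zero _ (Fact.out : p.Prime).ne_zero⟩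
  { toFun := fun a ↦
      { toFun := fun ζ ↦ (zmodSMulMu K (p ^ k) ζ).comp ((lamZMod S lam k).comp (AddMonoidHom.mulLeft a))
        map_zero' := by ext x; exact zmodSMulMu_zero K (p ^ k) _
        map_add' := fun ζ ζ' ↦ by ext x; exact zmodSMulMu_add K (p ^ k) ζ ζ' _ }
    map_zero' := by
      ext ζ x
      change zmodSMulMu K (p ^ k) ζ (lamZMod S lam k (0 * x)) = 0
      rw [zero_mul, map_zero, map_zero]
    map_add' := fun a b ↦ by
      ext ζ x
      change zmodSMulMu K (p ^ k) ζ (lamZMod S lam k ((a + b) * x)) = zmodSMulMu K (p ^ k) ζ (lamZMod S lam k (a * x)) + zmodSMulMu K (p ^ k) ζ (lamZMod S lam k (b * x))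
      rw [add_mul, map_add, map_add] }

/-- Unfolding `lamPairingAux`. [folklore] -/
theorem lamPairingAux_apply (k : ℕ) (a : padicCoeffIntegers S) (ζ : MuCarrier K (p ^ k)) (x : padicCoeffIntegers S) :
    lamPairingAux S K lam k a ζ x = (haveI : NeZero (p ^ k) := ⟨pow_ne_zero _ (Fact.out : p.Prime).ne_zero⟩; zmodSMulMu K (p ^ k) ζ (lamZMod S lam k (a * x))) :=
  rfl

/-- The `ℤ`-balance of `lamPairingAux` (needed to descend to the tensor product). [folklore] -/
theorem lamPairingAux_zsmul (k : ℕ) (r : ℤ) (a : padicCoeffIntegers S) (ζ : MuCarrier K (p ^ k)) :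
    lamPairingAux S K lam k (r • a) ζ = lamPairingAux S K lam k a (r • ζ) := by
  haveI : NeZero (p ^ k) := ⟨pow_ne_zero _ (Fact.out : p.Prime).ne_zero⟩
  ext x
  rw [lamPairingAux_apply, lamPairingAux_apply, smul_mul_assoc, map_zsmul]
  obtain ⟨w, hw⟩ := ZMod.intCast_surjective (lamZMod S lam k (a * x))
  rw [← hw, zsmul_eq_mul, ← Int.cast_mul, zmodSMulMu_intCast, zmodSMulMu_intCast, mul_comm, mul_zsmul]

/-- ★ **The trace pairing `(a ⊗ ζ, x) ↦ λ(a x)·ζ : 𝒪 ⊗ μ_{p^k} → Hom(𝒪, μ_{p^k})`.** [cite: Rubin2000, §4.2] [cite: NeukirchSchmidtWingberg2008, (7.2.6)] -/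
def lamPairing (k : ℕ) : OMuCarrier K S (p ^ k) →+ (padicCoeffIntegers S →+ MuCarrier K (p ^ k)) :=
  (TensorProduct.liftAddHom (lamPairingAux S K lam k) (lamPairingAux_zsmul S K lam k)).comp OMuCarrier.toTensor.toAddMonoidHom

/-- ★ The trace pairing on pure tensors: `(a ⊗ ζ, x) ↦ λ(a x)·ζ`. [cite: Rubin2000, §4.2] -/
theorem lamPairing_tmul (k : ℕ) (a : padicCoeffIntegers S) (ζ : MuCarrier K (p ^ k)) (x : padicCoeffIntegers S) :
    lamPairing S K lam k (OMuCarrier.tmul a ζ) x =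
      (haveI : NeZero (p ^ k) := ⟨pow_ne_zero _ (Fact.out : p.Prime).ne_zero⟩; zmodSMulMu K (p ^ k) ζ (lamZMod S lam k (a * x))) := by
  change (TensorProduct.liftAddHom (lamPairingAux S K lam k) (lamPairingAux_zsmul S K lam k)) (a ⊗ₜ ζ) x = _
  rw [TensorProduct.liftAddHom_tmul, lamPairingAux_apply]

/-- ★ **`𝒪`-balance**: `((c ⊗ id) w, x) = (w, c x)`. [cite: Rubin2000, §4.2] -/
theorem lamPairing_oMuScalar (k : ℕ) (c : padicCoeffIntegers S) (w : OMuCarrier K S (p ^ k)) (x : padicCoeffIntegers S) :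
    lamPairing S K lam k (oMuScalar S (p ^ k) c w) x = lamPairing S K lam k w (c * x) := by
  induction w using OMuCarrier.induction_on with
  | zero => simp only [map_zero, AddMonoidHom.zero_apply]
  | tmul a ζ => rw [oMuScalar_tmul, lamPairing_tmul, lamPairing_tmul, mul_assoc, mul_left_comm]
  | add y z hy hz => rw [map_add, map_add, AddMonoidHom.add_apply, hy, hz, map_add, AddMonoidHom.add_apply]

include hlam in
/-- ★ **`p^k 𝒪` lies in the right kernel**: `(w, p^k y) = 0` (so the pairing descends to `𝒪/p^k ≅ M[p^k]`). [cite: Rubin2000, §4.2] -/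
theorem lamPairing_natCast_pow_mul (k : ℕ) (w : OMuCarrier K S (p ^ k)) (y : padicCoeffIntegers S) :
    lamPairing S K lam k w (((p : ℕ) : padicCoeffIntegers S) ^ k * y) = 0 := by
  haveI : NeZero (p ^ k) := ⟨pow_ne_zero _ (Fact.out : p.Prime).ne_zero⟩
  induction w using OMuCarrier.induction_on with
  | zero => simp only [map_zero, AddMonoidHom.zero_apply]
  | tmul a ζ => rw [lamPairing_tmul, mul_left_comm, lamZMod_natCast_pow_mul S lam hlam, map_zero]
  | add y z hy hz => rw [map_add, AddMonoidHom.add_apply, hy, hz, add_zero]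

include hlam in
/-- ★ **Level compatibility**: `ι((red w, y)_k) = (w, p y)_{k+1}` for `red = id ⊗ (ζ ↦ ζ^p)` (honda's `oMuRed`) and `ι : μ_{p^k} ⊆ μ_{p^{k+1}}` — under `M[p^k] ≅ 𝒪/p^k` the inclusion
`M[p^k] ⊆ M[p^{k+1}]` is `y ↦ p y`. [cite: NeukirchSchmidtWingberg2008, (7.1.4), (7.2.6)] -/
theorem muInclusion_lamPairing_oMuRed (k : ℕ) (w : OMuCarrier K S (p ^ (k + 1))) (y : padicCoeffIntegers S) :
    (haveI : NeZero (p ^ k) := ⟨pow_ne_zero _ (Fact.out : p.Prime).ne_zero⟩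
     haveI : NeZero (p ^ (k + 1)) := ⟨pow_ne_zero _ (Fact.out : p.Prime).ne_zero⟩
     muInclusion K (pow_dvd_pow p (Nat.le_succ k)) (lamPairing S K lam k (oMuRed S k w) y)) = lamPairing S K lam (k + 1) w (((p : ℕ) : padicCoeffIntegers S) * y) := by
  haveI : NeZero (p ^ k) := ⟨pow_ne_zero _ (Fact.out : p.Prime).ne_zero⟩
  haveI : NeZero (p ^ (k + 1)) := ⟨pow_ne_zero _ (Fact.out : p.Prime).ne_zero⟩
  induction w using OMuCarrier.induction_on with
  | zero => simp only [map_zero, AddMonoidHom.zero_apply]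
  | tmul a ζ =>
    rw [oMuRed_tmul, lamPairing_tmul, lamPairing_tmul, mul_left_comm,
      show ((p : ℕ) : padicCoeffIntegers S) = padicIntToCoeffIntegers S (p : ℤ_[p]) by rw [map_natCast], lamZMod_padicInt_mul S lam hlam, map_natCast]
    obtain ⟨z, hz⟩ := ZMod.intCast_surjective (lamZMod S lam (k + 1) (a * y))
    have hk : lamZMod S lam k (a * y) = (z : ZMod (p ^ k)) := by
      rw [← lamZMod_succ_cast, ← hz, map_intCast]
    rw [hk, map_zmodSMulMu, muInclusion_muPowMap, ← hz, ← Int.cast_natCast, ← Int.cast_mul, zmodSMulMu_intCast, mul_comm, mul_zsmul, natCast_zsmul]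
  | add u u' hu hu' => rw [map_add, map_add, AddMonoidHom.add_apply, map_add, hu, hu', map_add, AddMonoidHom.add_apply]

variable {K} in
/-- ★ **The twist law** (Galois equivariance in coordinates): for `σ ∈ Γ_K` and `t ∈ 𝒪` with `θ′(σ)·t = 1`, `((σ·w), t x) = σ·(w, x)` where `σ` acts on `𝒪 ⊗ μ ⊗ θ′` by honda's
`muTwistO` (`a ⊗ ζ ↦ θ′(σ)a ⊗ σζ`) and on `μ_{p^k}` through `mu`; with `t = θ(σ)` and `θθ′ = 1` this is the equivariance against `(F/𝒪)(θ)[p^k] ≅ (𝒪/p^k)(θ)`.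
[cite: Rubin2000, §4.2] [cite: JohnsonLeungKings2011, Def. 4.2] -/
theorem lamPairing_muTwistO [NumberField K] (θ' : absoluteGaloisGroup K →ₜ* (padicCoeffIntegers S)ˣ) (k : ℕ) (σ : absoluteGaloisGroup K) (t : padicCoeffIntegers S)
    (ht : ((θ' σ : (padicCoeffIntegers S)ˣ) : padicCoeffIntegers S) * t = 1) (w : OMuCarrier K S (p ^ k)) (x : padicCoeffIntegers S) :
    (haveI : NeZero (p ^ k) := ⟨pow_ne_zero _ (Fact.out : p.Prime).ne_zero⟩
     lamPairing S K lam k (muTwistO S θ' k σ w) (t * x)) =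
      (haveI : NeZero (p ^ k) := ⟨pow_ne_zero _ (Fact.out : p.Prime).ne_zero⟩; mu K (p ^ k) σ (lamPairing S K lam k w x)) := by
  haveI : NeZero (p ^ k) := ⟨pow_ne_zero _ (Fact.out : p.Prime).ne_zero⟩
  induction w using OMuCarrier.induction_on with
  | zero => simp only [map_zero, AddMonoidHom.zero_apply]
  | tmul a ζ =>
    rw [muTwistO_tmul, lamPairing_tmul, lamPairing_tmul, show (θ' σ : padicCoeffIntegers S) * a * (t * x) = a * x by
      rw [mul_comm _ a, mul_assoc, ← mul_assoc _ t, ht, one_mul]]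
    obtain ⟨z, hz⟩ := ZMod.intCast_surjective (lamZMod S lam k (a * x))
    rw [← hz, zmodSMulMu_intCast, zmodSMulMu_intCast, map_zsmul]
  | add u u' hu hu' => rw [map_add, map_add, AddMonoidHom.add_apply, hu, hu', map_add, AddMonoidHom.add_apply, map_add]

end Pairing

end Summit.BirchSwinnertonDyer.BirchSwinnertonDyer.Theorems.SmallImageRttD2Seq

end
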